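import Summits.CriticalPhenomena.PercolationContinuityZ3.Theorems.PercNearOneGluingNoHeavyQuantSliceSmallLayers
import Summits.CriticalPhenomena.PercolationContinuityZ3.Theorems.PercNearOneGluingNoHeavyQuantSliceSingleLayerLaws
import Summits.CriticalPhenomena.PercolationContinuityZ3.Theorems.PercNearOneGluingNoHeavyQuantDECAtTarget
import HarnessLib

/-!
# QUANT lane R8, T-DEC, leg (III), blob case: the WINDOW FORM of the blob gate step (`LawDec.GatedSliceWindowDEC`, the statement of
# record after V313/V317/V318) and its DUAL REDUCTION TARGET — one law-level statement about explicit ≤ 7-atom laws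
# (`LawDec.GatedSliceMixLaw`); the weak-mid law `LawDec.weakMidLaw` and its bookkeeping

builds on p205010 (kernel theorem, internal audit signed; external expert review pending)

Statement + support file (`--supports stmt-CriticalPhenomena-4575`), QUANT lane typer seat prim-quant-stmt (gen 29), rung R8 of
`run/shared/lean/prim/quant/LADDER.md`.  Memo `run/shared/lean/prim/quant/prim-quant-stmt-g29/GATED-SLICE-DUAL-G29.md`.  One small
definition, two `@[conjecture]`s, theorems with standard axioms, no sorries.

THE SETTING (README V318/V319, `FOR-PROVERS-CW.md`).  `ν` a probability law on `{0..M}` (mean `S`, top-affordable `y·M ≤ S`), a blob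
`(a ≥ 1, g ≤ 1)`, a gate-zero `0 ≤ z ≤ ν 0` with the threshold `y ≤ (1−z)·g`; the MOVED LAW `P := slice ν a g + g z (δ₀ − δ_a)`
(= `(1−g)·ν + g·shiftBut ν a z` = `z·δ₀ + (1−z)·slice ν̂ a g`, `ν̂ = (ν − zδ₀)/(1−z)`), target `t = S + a g (1−z)`.  With `ν = gate_q μ`,
`z = 1−q`, `y = q·x`, `P = gate_q (slice μ a g)`: DEC of `P` at every layer is exactly the blob case of `SDECUpTo`-closure (leg (III)).
Every ONE-LAYER form of this step is refuted in the tree (`not_mixedShiftDEC`, arm-3's `TwinMoveWitness`, lead g30's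
`gateMoveBlob_general_witness`); the statement of record is the WINDOW form **`GatedSliceWindowDEC`** below: `ν` DEC at `(y, S, i)` for
EVERY layer `i ∈ [j−a, j]` ⟹ `P` DEC at `(y, t, j)` (evidence: 0 failures on > 6·10⁶ exact instances, lead g28–g30 / arm-3 g60–g62).

THE DUAL ROUTE (this seat; all checks exact, `explore/` of the seat folder).  For a price system `(α, β)` of the `P`-positions at `(y,t,j)`
let `e = coefAt t j α β` and `Φ(k) = (1−g)e(k) + g·e(k+a)` (`= slicePullback t g j a α β`), so that `⟨e, P⟩ = ⟨Φ, ν⟩ + g z (α 0 − e a)`.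
(1) By the slice theorem's single-layer machinery (`sliceMidLemmaD_holds`, `sliceMidLemmaW_holds`; base target `T₀ = t − ag = S − agz`) there
is a window layer `J` (the largest cheap window atom, or `j − a`) at which `Φ` is a price functional at target `T₀ ≤ S`, hence at `S`, and
every `ν`-giant above `J` carries credit `≥ β(q₀) ≥ α 0·(1−y)/y` (`q₀` a cheapest `P`-giant).  (2) If moreover every `ν`-MID `h ≤ J` with
`h > S` carries credit `S·(−Φ h) ≥ α 0·(h − S)` ("no weak mid"), the zero can be re-priced from `Φ 0` up to `α 0` and weak duality at
`(S, J)` gives `⟨e, P⟩ ≤ ⟨Φ,ν⟩ + g ν0 (α 0 − e a) ≤ 0` (uses `z ≤ ν 0`).  (3) A WEAK MID `h` (`S·(−Φ h) < α 0·(h−S)`) is exactly a violation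
`⟨e, W_h⟩ > 0` of the explicit law `W_h = weakMidLaw S g h a = (1 − S/h)δ₀ + (S/h)(1−g)δ_h + (S/h)g δ_{h+a}` (`sum_coef_weakMidLaw`).  Writing
`ν̂` as a mixture of two-point laws `μ₂` of mean `T = S/(1−z)` (Lemma P, `exists_twoPoint_decomposition`), `P = Σ w·P[μ₂]` with
`P[μ₂] = zδ₀ + (1−z)·slice μ₂ a g`, and `⟨e, P⟩ ≤ 0` follows if for each `μ₂` SOME mixture `θ W_h + (1−θ) P[μ₂]` (`θ < 1`) is DEC at `(y,t,j)`:
that is the law-level statement **`GatedSliceMixLaw`** below (by Gordan's alternative it is EQUIVALENT to "every price system violated by `W_h`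
is satisfied by `P[μ₂]`").  So **`GatedSliceMixLaw → GatedSliceWindowDEC`** (the reduction is the companion files `…QuantGatedSliceWindowLayer`,
`…QuantGatedSliceWindowReduction`).  EVIDENCE (exact rationals, 0 failures): `GatedSliceMixLaw` on 94 600 `(params, h, μ₂)` cases incl. the
V318 corner family (in 99.7 % `P[μ₂]` is itself DEC; the 155 genuine mixtures include V318's `μ₂ = {1, 20}` with `h = 5, 6`, `θ ≈ 0.96, 0.92`,
where NEITHER `W_h` NOR `P[μ₂]` is DEC); the dichotomy "(2) or (3)" on 3 100 extreme rays / ray sums of the price cone (M ≤ 6, a ≤ 4) and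
≈ 900 edge / adversarial instances; the general affine-tilt single-layer domination at the layer of (1) in all of them.
HONEST STATUS: `GatedSliceWindowDEC`, `GatedSliceMixLaw`, `GateMove`, `GatedConvEmptyFree`, `SingleGateConvClosed`, `TreeDEC`, `FarTreeRow` OPEN;
RATE class log* / honest sentence unchanged.

* `LawDec.weakMidLaw S g h a` — the law `W_h`; `weakMidLaw_nonneg`, `weakMidLaw_eq_zero`, `sum_weakMidLaw`, `sum_coef_weakMidLaw`
  (bookkeeping via `sum_mul_indicator` of `…SliceSingleLayerLaws`).
* **`LawDec.GatedSliceWindowDEC`** (`@[conjecture]`) — CW, the window form of the blob gate step.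
* **`LawDec.GatedSliceMixLaw`** (`@[conjecture]`) — the law-level reduction target.

[this work]; window form: lead g28 V300 / g30 V318 (this lane); single-layer machinery: census-2 g54–g55, typer g24.  Gordan/Farkas
[cite: Schrijver1986, Cor 7.1f (p. 90)].  The gluing rows served [cite: KozmaNitzan2024, Conjecture 3 (p. 15)]; product measure
[cite: Grimmett1999, §1.3 p. 10].
-/

noncomputable section

namespace Summit.CriticalPhenomena.PercolationContinuityZ3.Theorems

namespace Quant

open Finset

/-- the two-point law `{lo, hi; g}` (as in `…QuantLawDEC`) -/
local notation3 "TP[" lo ", " hi ", " g ", " h "]" =>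
  (g : ℝ) * (if (h : ℕ) = (hi : ℕ) then (1 : ℝ) else 0) + (1 - (g : ℝ)) * (if (h : ℕ) = (lo : ℕ) then (1 : ℝ) else 0)

namespace LawDec

/-! ### The weak-mid law -/

/-- **the weak-mid law** `W_h = (1 − S/h)·δ₀ + (S/h)·(1−g)·δ_h + (S/h)·g·δ_{h+a}`: the zero–mid component `{0, h; S/h}` of target `S`
(mean `S`, zero mass `1 − S/h ≥ z` iff `h ≥ S/(1−z)`) with the blob `{0,a;g}` attached to its `h`-atom only (the zero keeps its full mass).
A price system `e` of the moved law's positions has a WEAK MID at `h` iff `⟨e, W_h⟩ > 0` (`sum_coef_weakMidLaw`). [this work] -/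
def weakMidLaw (S g : ℝ) (h a : ℕ) : ℕ → ℝ := fun p =>
  (1 - S / h) * (if p = 0 then (1 : ℝ) else 0) + S / h * (1 - g) * (if p = h then (1 : ℝ) else 0)
    + S / h * g * (if p = h + a then (1 : ℝ) else 0)

/-- `W_h ≥ 0` for `0 ≤ S ≤ h`, `0 ≤ g ≤ 1`. [this work] -/
theorem weakMidLaw_nonneg (S g : ℝ) (h a : ℕ) (hS0 : 0 ≤ S) (hSh : S ≤ (h : ℝ)) (hg0 : 0 ≤ g) (hg1 : g ≤ 1) (p : ℕ) :
    0 ≤ weakMidLaw S g h a p := by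
  unfold weakMidLaw
  have hh0 : (0 : ℝ) ≤ (h : ℝ) := Nat.cast_nonneg h
  have hq : 0 ≤ S / (h : ℝ) := div_nonneg hS0 hh0
  have hq1 : S / (h : ℝ) ≤ 1 := by
    rcases hh0.eq_or_lt with hz | hpos
    · rw [← hz, div_zero]; norm_num
    · rw [div_le_one hpos]; exact hSh
  refine add_nonneg (add_nonneg (mul_nonneg (by linarith) ?_) (mul_nonneg (mul_nonneg hq (by linarith)) ?_))
    (mul_nonneg (mul_nonneg hq hg0) ?_) <;> split_ifs <;> norm_num

/-- `W_h` vanishes above `h + a`. [this work] -/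
theorem weakMidLaw_eq_zero (S g : ℝ) (h a p : ℕ) (hp : h + a < p) : weakMidLaw S g h a p = 0 := by
  unfold weakMidLaw
  rw [if_neg (by omega), if_neg (by omega), if_neg (by omega)]
  ring

/-- **a functional against `W_h`**: `Σ_{p ≤ N} F p · W_h p = (1 − S/h)·F 0 + (S/h)·((1−g)·F h + g·F (h+a))` for `h + a ≤ N`. [this work] -/
theorem sum_coef_weakMidLaw (F : ℕ → ℝ) (S g : ℝ) (h a N : ℕ) (hN : h + a ≤ N) :
    ∑ p ∈ Finset.range (N + 1), F p * weakMidLaw S g h a p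
      = (1 - S / h) * F 0 + S / h * ((1 - g) * F h + g * F (h + a)) := by
  unfold weakMidLaw
  have e : ∀ p ∈ Finset.range (N + 1),
      F p * ((1 - S / h) * (if p = 0 then (1 : ℝ) else 0) + S / h * (1 - g) * (if p = h then (1 : ℝ) else 0)
        + S / h * g * (if p = h + a then (1 : ℝ) else 0))
      = (1 - S / h) * (F p * (if p = 0 then (1 : ℝ) else 0)) + S / h * (1 - g) * (F p * (if p = h then (1 : ℝ) else 0))
        + S / h * g * (F p * (if p = h + a then (1 : ℝ) else 0)) := by
    intro p _; ring
  rw [Finset.sum_congr rfl e, Finset.sum_add_distrib, Finset.sum_add_distrib, ← Finset.mul_sum, ← Finset.mul_sum, ← Finset.mul_sum,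
    sum_mul_indicator F N 0 (by omega), sum_mul_indicator F N h (by omega), sum_mul_indicator F N (h + a) hN]
  ring

/-- `W_h` has mass `1` on `{0..N}` for `h + a ≤ N`. [this work] -/
theorem sum_weakMidLaw (S g : ℝ) (h a N : ℕ) (hN : h + a ≤ N) :
    ∑ p ∈ Finset.range (N + 1), weakMidLaw S g h a p = 1 := by
  have := sum_coef_weakMidLaw (fun _ => (1 : ℝ)) S g h a N hN
  simp only [one_mul] at this
  rw [this]; ring

/-! ### The window form of the blob gate step -/

/-- **CONJECTURE CW (the WINDOW form of the blob gate step; lead g28 V300 "PM1-window", lead g30 V318/V319 statement of record).**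
`0 < y < 1`, `0 ≤ z ≤ ν 0`, `g ≤ 1`, `y ≤ (1−z)·g`, `1 ≤ a`; `ν ≥ 0` a probability law on `{0..M}` with mean `S` and `y·M ≤ S`; a layer
`j < M + a`.  IF `ν` is DEC at `(y, S, i)` on `{0..M}` for EVERY layer `i` of the window `[j − a, j]` (the layers `i ≥ M` hold by Theorem A,
`decAt_of_top_le`), THEN the moved law `P = slice ν a g + g z (δ₀ − δ_a)` is DEC at `(y, S + ag − zag, j)` on `{0..M+a}` — the binder of the
refuted one-layer move `decAtT_gateMoveBlob` WITHOUT `hsupp` and with the single-layer hypothesis replaced by the window.  With `ν = gate_q μ`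
(`z = 1−q`, `y = qx`) the conclusion is `gate_q (slice μ a g) ∈ D(q(T + ag), j)`: the blob case of `SDECUpTo`-closure / leg (III).
EVIDENCE: 0 failures on > 6·10⁶ exact boundary-pushed instances (arm-3 g60/g61 PM1-window 5 780 088; lead kit j170250–52, j172077; lead corner
families t19–t23); every one-layer weakening is refuted in the tree.  Reduction: `GatedSliceMixLaw → GatedSliceWindowDEC` (companion files).
builds on p205010 (kernel theorem, internal audit signed; external expert review pending). [this work] [status: open] -/
@[conjecture] def GatedSliceWindowDEC : Prop :=
  ∀ (y z g S : ℝ) (a j M : ℕ) (ν : ℕ → ℝ),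
    0 < y → y < 1 → 0 ≤ z → z ≤ ν 0 → g ≤ 1 → y ≤ (1 - z) * g → 1 ≤ a →
    (∀ h, 0 ≤ ν h) → (∀ h, M < h → ν h = 0) → (∑ h ∈ Finset.range (M + 1), ν h = 1) →
    S = ∑ h ∈ Finset.range (M + 1), (h : ℝ) * ν h → y * (M : ℝ) ≤ S →
    j < M + a →
    (∀ i, i ≤ j → j ≤ i + a → DECAtT y S i M ν) →
    DECAtT y (S + (a : ℝ) * g - z * (a : ℝ) * g) j (M + a)
      (fun h => slice ν a g h + g * z * ((if h = 0 then (1 : ℝ) else 0) - (if h = a then (1 : ℝ) else 0)))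

/-! ### The law-level reduction target -/

/-- **CONJECTURE MW (mixing a weak-mid law into the moved two-point laws; typer g29).**  Frame: `0 < y < 1`, `0 ≤ z < 1`, `g ≤ 1`,
`y ≤ (1−z)g`, `1 ≤ a`, `j < M + a`, `0 < S`, `y·M ≤ S`, target `t = S + ag(1−z)`.  For every atom `h` with `S < h ≤ min(j, M)` and every
two-point law `μ₂ = {k₁, k₂; λ}` on `{0..M}` of mean `T = S/(1−z)` (`k₁ ≤ k₂ ≤ M`, `0 ≤ λ ≤ 1`, `(1−z)((1−λ)k₁ + λk₂) = S`) there is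
`0 ≤ θ < 1` such that the mixture `θ·W_h + (1−θ)·P[μ₂]` is DEC at `(y, t, j)` on `{0..M+a}`, where `W_h = weakMidLaw S g h a` and
`P[μ₂] = z·δ₀ + (1−z)·slice μ₂ a g` is the moved law of the gated two-point law.  In 99.7 % of the tested cases `θ = 0` works (`P[μ₂]` itself
DEC); the mixture is genuinely needed e.g. at lead g30's V318 parameters (`M = 20, a = 2, g = 1/4, z = 7/45, y = 97/540, S = 97/27, j = 8`)
for `μ₂ = {1, 20}`, `h = 5` (`θ ≈ 0.96`; neither law is DEC alone).  EVIDENCE: exact LP with `θ` free, 94 600 cases / 0 failures (seat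
`explore/l4.py`).  `GatedSliceMixLaw → GatedSliceWindowDEC`.  builds on p205010 (kernel theorem, internal audit signed; external expert
review pending). [this work] [status: open] -/
@[conjecture] def GatedSliceMixLaw : Prop :=
  ∀ (y z g S lam : ℝ) (a j M h k₁ k₂ : ℕ),
    0 < y → y < 1 → 0 ≤ z → z < 1 → g ≤ 1 → y ≤ (1 - z) * g → 1 ≤ a → j < M + a → 0 < S → y * (M : ℝ) ≤ S →
    h ≤ j → h ≤ M → S < (h : ℝ) →
    k₁ ≤ k₂ → k₂ ≤ M → 0 ≤ lam → lam ≤ 1 → (1 - z) * ((k₁ : ℝ) + ((k₂ : ℝ) - k₁) * lam) = S →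
    ∃ θ : ℝ, 0 ≤ θ ∧ θ < 1 ∧
      DECAtT y (S + (a : ℝ) * g * (1 - z)) j (M + a)
        (fun p => θ * weakMidLaw S g h a p
          + (1 - θ) * (z * (if p = 0 then (1 : ℝ) else 0) + (1 - z) * slice (fun q => TP[k₁, k₂, lam, q]) a g p))

end LawDec

end Quant

end Summit.CriticalPhenomena.PercolationContinuityZ3.Theorems
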